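import Mathlib
import Summits.Ventures.PercRepro2.OStarGlue
import Summits.Ventures.PercRepro2.BStarCert

/-!
# The gluing lemma for the star of `b`, and row 2′TRI when `b` is adjacent only to `o, a₁, a₂`
(blind cell PercRepro2, mine-2 g39, 2026-08-28; `proofs/MINE2-GLUE.md` §6, row M2-83)

The mirror of `OStarGlue.lean`: the star at `b` with its edges confined to `a₁, a₂, o` is the
structure `Star ends b a₁ a₂ a₃ o e₁ e₂ eo` of that file with the poles exchanged (the slot
`eb` there is the edge `b–o` here), the rest's pattern `pat ends b a₁ a₂ a₃ o x` lives on
`a₁, a₂, a₃, o`, and the state of a copy is the glued `b`-state `Sb` of `BStarModel.lean`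
(`Star.st_eq_Sb`: `b`'s sides are read off `reach`, `o`'s off the glued connection to the mark
`3 = o`).  Everything else of the gluing — the side kernel (`K3_eq_side_b`), the product of the
typed triples of the two sides, the symmetrisation over the rest's copies, the peeling of the
three slots — is the generic part of `OStarGlue.lean` applied verbatim, and the certificate is
`Cb_nonneg` (`BStarCert.lean`).  **`typedCount_nonneg_of_bstar`**, **`TypedBases_of_bstar`**,
**`HCov_of_bstar`**: row 2′TRI and (HCOV) for every admissible weight vector on every finite graph
in which every edge at `b` leads to `o`, `a₁` or `a₂` (at most one edge to each) — the `b`-patterns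
`{o}, {o, a₁}, {o, a₂}, {o, a₁, a₂}` of `proofs/MINE2-GADGET.md` §7 and the `b`-separation zeros.
Own code; standard axioms.
-/

namespace Summit.Ventures.PercRepro2

open UnionCluster

namespace CovForm

namespace OStar

open OneTyped Untouched TypedFactor SepThree TypedRed StarGlue

section BMain

variable {V : Type*} {E : Type*} [Fintype E] [DecidableEq V] [DecidableEq E]
variable {ends : E → Sym2 V} {o a₁ a₂ a₃ b : V} [DecidablePred (· ∈ (touches ends {b})ᶜ)]
  {e₁ e₂ eo : Option E} {R : Type*} [Field R] [LinearOrder R] [IsStrictOrderedRing R]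

omit [Fintype E] [DecidableEq V] [DecidableEq E] [LinearOrder R] [IsStrictOrderedRing R] in
/-- **The gluing lemma for states, at `b`**: the state of a copy is the glued `b`-state of the
rest's pattern on `a₁, a₂, a₃, o` and the open-neighbour set of `b`. -/
theorem Star.st_eq_Sb (hS : Star ends b a₁ a₂ a₃ o e₁ e₂ eo) (x : Config E) :
    st ends o a₁ a₂ a₃ b x = Sb (pat ends b a₁ a₂ a₃ o x) (nbr e₁ e₂ eo x) := by
  unfold st Sb
  simp only [Prod.mk.injEq]
  refine ⟨?_, ?_, ?_, ?_, ?_, ?_, ?_⟩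
  · exact Bool.eq_iff_iff.2 (by simp only [decide_eq_true_eq]; exact (hS.connG_iff x 1 0).symm)
  · exact Bool.eq_iff_iff.2 (by simp only [decide_eq_true_eq]; exact (hS.connG_iff x 0 3).symm)
  · exact Bool.eq_iff_iff.2 (by simp only [decide_eq_true_eq]; exact (hS.connG_iff x 1 3).symm)
  · exact Bool.eq_iff_iff.2 (by simp only [decide_eq_true_eq]; exact (hS.reach_iff_conn x 0).symm)
  · exact Bool.eq_iff_iff.2 (by simp only [decide_eq_true_eq]; exact (hS.reach_iff_conn x 1).symm)
  · exact Bool.eq_iff_iff.2 (by simp only [decide_eq_true_eq]; exact (hS.connG_iff x 0 2).symm)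
  · exact Bool.eq_iff_iff.2 (by simp only [decide_eq_true_eq]; exact (hS.connG_iff x 1 2).symm)

variable (ends o a₁ a₂ a₃ b e₁ e₂ eo)

/-- The kernel on the side restrictions of the `b`-star: `KB` on the glued `b`-states. -/
noncomputable def Φb : Config E → Config E → Config E → Config E → Config E → Config E → R :=
  fun xa ya wa xb yb wb =>
    ((KB (Sb (pat ends b a₁ a₂ a₃ o xb) (nbr e₁ e₂ eo xa))
      (Sb (pat ends b a₁ a₂ a₃ o yb) (nbr e₁ e₂ eo ya))
      (Sb (pat ends b a₁ a₂ a₃ o wb) (nbr e₁ e₂ eo wa)) : ℤ) : R)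

variable {ends o a₁ a₂ a₃ b e₁ e₂ eo}

omit [Fintype E] [LinearOrder R] [IsStrictOrderedRing R] in
/-- **`K₃` on the support is the side kernel of `Φb`** (`A` = the typed edges at `b`). -/
theorem K3_eq_side_b (hS : Star ends b a₁ a₂ a₃ o e₁ e₂ eo) (F : Finset E) (z : Config E)
    {x y w : Config E} (hx : ∀ e, e ∉ F → x e = z e) (hy : ∀ e, e ∉ F → y e = z e)
    (hw : ∀ e, e ∉ F → w e = z e) :
    (K3 ends o a₁ a₂ a₃ b x y w : R) =
      sideKernel (sideA ends b F) (sideB ends b F) z (Φb ends o a₁ a₂ a₃ b e₁ e₂ eo) x y w := by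
  rw [K3_eq_KB, hS.st_eq_Sb x, hS.st_eq_Sb y, hS.st_eq_Sb w]
  unfold sideKernel Φb
  rw [nbr_restr_sideA hS hx, nbr_restr_sideA hS hy, nbr_restr_sideA hS hw, pat_restr_sideB hx,
    pat_restr_sideB hy, pat_restr_sideB hw]

omit [Fintype E] [DecidableEq V] [DecidableEq E] [LinearOrder R] [IsStrictOrderedRing R] in
/-- The `B`-symmetrisation of `Φb` is `PSYMb`. -/
lemma symB_Φb (xa ya wa xb yb wb : Config E) :
    symB (Φb ends o a₁ a₂ a₃ b e₁ e₂ eo) xa ya wa xb yb wb =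
      ((PSYMb (nbr e₁ e₂ eo xa) (nbr e₁ e₂ eo ya) (nbr e₁ e₂ eo wa) (pat ends b a₁ a₂ a₃ o xb)
        (pat ends b a₁ a₂ a₃ o yb) (pat ends b a₁ a₂ a₃ o wb) : ℤ) : R) := by
  unfold symB Φb PSYMb
  push_cast
  ring

omit [Fintype E] [DecidableEq V] [DecidableEq E] [DecidablePred (· ∈ (touches ends {b})ᶜ)]
  [LinearOrder R] [IsStrictOrderedRing R] in
/-- The cast of the `b`-gadget sum is the `plc` sum of the casts. -/
lemma cast_Cb (t₁ t₂ tO : ℕ) (P₁ P₂ P₃ : Pat) :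
    ((Cb t₁ t₂ tO P₁ P₂ P₃ : ℤ) : R) =
      ((plc t₁).map fun c₁ => ((plc t₂).map fun c₂ => ((plc tO).map fun cO =>
        ((PSYMb (c₁.1, c₂.1, cO.1) (c₁.2.1, c₂.2.1, cO.2.1) (c₁.2.2, c₂.2.2, cO.2.2)
          P₁ P₂ P₃ : ℤ) : R)).sum).sum).sum := by
  simp only [Cb, Int.cast_list_sum, List.map_map, Function.comp_def]

omit [LinearOrder R] [IsStrictOrderedRing R] in
/-- **THE GLUING THEOREM AT `b`**: six times the typed count of `K₃` is the sum, over the typed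
triples of the rest, of the `b`-gadget sum of the star's typing at the rest's pattern triple. -/
theorem six_mul_typedCount_eq_b (hS : Star ends b a₁ a₂ a₃ o e₁ e₂ eo) (F : Finset E)
    (z : Config E) (τ : E → ℕ) :
    6 * typedCount F z τ (K3 ends o a₁ a₂ a₃ b : Config E → Config E → Config E → R) =
      ∑ xb : Config E, ∑ yb : Config E, ∑ wb : Config E,
        if cond (sideB ends b F) z τ xb yb wb then
          ((Cb (typ e₁ (sideA ends b F) z τ) (typ e₂ (sideA ends b F) z τ)
            (typ eo (sideA ends b F) z τ) (pat ends b a₁ a₂ a₃ o xb) (pat ends b a₁ a₂ a₃ o yb)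
            (pat ends b a₁ a₂ a₃ o wb) : ℤ) : R)
        else 0 := by
  have hside : typedCount F z τ (K3 ends o a₁ a₂ a₃ b : Config E → Config E → Config E → R) =
      typedCount F z τ (sideKernel (sideA ends b F) (sideB ends b F) z
        (Φb ends o a₁ a₂ a₃ b e₁ e₂ eo)) :=
    typedCount_congr_on_support F z τ fun x y w hc _ =>
      K3_eq_side_b hS F z (fun e he => (hc e he).1) (fun e he => (hc e he).2.1)
        (fun e he => (hc e he).2.2)
  rw [hside, six_mul_typedCount_sideB F (sideB_subset F) (disjoint_sideA_sideB F) z τ]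
  have hU := typedCount_eq_sum_AB (sideA ends b F) (sideB ends b F) (disjoint_sideA_sideB F) z τ
    (sideKernel (sideA ends b F) (sideB ends b F) z
      (symB (Φb (R := R) ends o a₁ a₂ a₃ b e₁ e₂ eo)))
  rw [sideA_union_sideB] at hU
  rw [hU]
  refine Finset.sum_congr rfl fun xb _ => Finset.sum_congr rfl fun yb _ =>
    Finset.sum_congr rfl fun wb _ => ?_
  by_cases hB : cond (sideB ends b F) z τ xb yb wb
  · rw [if_pos hB]
    have hinner : ∀ xa ya wa : Config E,
        (if cond (sideA ends b F) z τ xa ya wa ∧ cond (sideB ends b F) z τ xb yb wb then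
          sideKernel (sideA ends b F) (sideB ends b F) z (symB (Φb ends o a₁ a₂ a₃ b e₁ e₂ eo))
            (merge (sideA ends b F) (sideB ends b F) z xa xb)
            (merge (sideA ends b F) (sideB ends b F) z ya yb)
            (merge (sideA ends b F) (sideB ends b F) z wa wb) else 0) =
        if cond (sideA ends b F) z τ xa ya wa then
          ((PSYMb (nbr e₁ e₂ eo xa) (nbr e₁ e₂ eo ya) (nbr e₁ e₂ eo wa) (pat ends b a₁ a₂ a₃ o xb)
            (pat ends b a₁ a₂ a₃ o yb) (pat ends b a₁ a₂ a₃ o wb) : ℤ) : R) else 0 := by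
      intro xa ya wa
      by_cases hA : cond (sideA ends b F) z τ xa ya wa
      · rw [if_pos ⟨hA, hB⟩, if_pos hA]
        unfold sideKernel
        rw [restr_merge_left (fun e he => (hA.1 e he).1), restr_merge_left (fun e he => (hA.1 e he).2.1),
          restr_merge_left (fun e he => (hA.1 e he).2.2),
          restr_merge_right (disjoint_sideA_sideB F) (fun e he => (hB.1 e he).1),
          restr_merge_right (disjoint_sideA_sideB F) (fun e he => (hB.1 e he).2.1),
          restr_merge_right (disjoint_sideA_sideB F) (fun e he => (hB.1 e he).2.2), symB_Φb]
      · rw [if_neg (fun h => hA h.1), if_neg hA]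
    refine (Finset.sum_congr rfl fun xa _ => Finset.sum_congr rfl fun ya _ =>
      Finset.sum_congr rfl fun wa _ => hinner xa ya wa).trans ?_
    rw [← typedCount_eq_sum_cond, typedCount_star_eq hS (fun e he => (mem_sideA.1 he).2) z τ
      (fun N₁ N₂ N₃ => ((PSYMb N₁ N₂ N₃ (pat ends b a₁ a₂ a₃ o xb) (pat ends b a₁ a₂ a₃ o yb)
        (pat ends b a₁ a₂ a₃ o wb) : ℤ) : R)), cast_Cb]
  · rw [if_neg hB]
    refine Finset.sum_eq_zero fun xa _ => Finset.sum_eq_zero fun ya _ =>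
      Finset.sum_eq_zero fun wa _ => ?_
    rw [if_neg (fun h => hB h.2)]

/-- **Row 2′TRI on the `b`-star family**: when every edge at `b` leads to `o`, `a₁` or `a₂` (at most
one edge to each), every typed base of `K₃` is nonnegative. -/
theorem typedCount_nonneg_of_bstar (hS : Star ends b a₁ a₂ a₃ o e₁ e₂ eo) (F : Finset E)
    (z : Config E) (τ : E → ℕ) (hτ : ∀ e ∈ F, τ e = 1 ∨ τ e = 2) :
    0 ≤ typedCount F z τ (K3 ends o a₁ a₂ a₃ b : Config E → Config E → Config E → R) := by
  have h6 : 0 ≤ 6 * typedCount F z τ (K3 ends o a₁ a₂ a₃ b : Config E → Config E → Config E → R) := by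
    rw [six_mul_typedCount_eq_b hS F z τ]
    refine Finset.sum_nonneg fun xb _ => Finset.sum_nonneg fun yb _ =>
      Finset.sum_nonneg fun wb _ => ?_
    split_ifs
    · exact Int.cast_nonneg (Cb_nonneg (typ_le_three hτ e₁) (typ_le_three hτ e₂)
        (typ_le_three hτ eo) (valid_pat xb) (valid_pat yb) (valid_pat wb))
    · exact le_refl 0
  exact (mul_nonneg_iff_of_pos_left (by norm_num : (0 : R) < 6)).1 h6

/-- **The typed bases on the `b`-star family** (row 2′TRI as a class theorem). -/
theorem TypedBases_of_bstar (hS : Star ends b a₁ a₂ a₃ o e₁ e₂ eo) :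
    TypedBases (R := R) ends o a₁ a₂ a₃ b :=
  fun F z τ hτ => typedCount_nonneg_of_bstar hS F z τ hτ

/-- **(HCOV) on the `b`-star family** for every admissible weight vector. -/
theorem HCov_of_bstar (hS : Star ends b a₁ a₂ a₃ o e₁ e₂ eo) (p : E → R) (hp : IsProbVec p) :
    HCov p ends o a₁ a₂ a₃ b :=
  HCov_of_typedBases ends o a₁ a₂ a₃ b (TypedBases_of_bstar hS) p hp

end BMain

end OStar

end CovForm

end Summit.Ventures.PercRepro2
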